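import Mathlib
import Summits.BirchSwinnertonDyer.BirchSwinnertonDyer.Theorems.ResidualThetaTransportAtTwoSignedMuSeedAtTwoPlusNonsquareDescentGrowthCertificate
import Literature.NumberTheory.EllipticCurves.IwasawaAlgebra
import HarnessLib

/-!
# Non-square descent — IWASAWA GROWTH AT `μ = 0`, CLEANEST FORM: «`M/pM` FINITE ⟹ `#(M/ω_nM)` grows geometrically with constant ratio» over any local
# Noetherian coefficient ring, and the instance `Λ = ℤ_p⟦T⟧` in the tree's currency (`IwasawaAlgebra p`, `augIdealP p`) — seed crux `SignedMuSeedAtTwoPlus`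
# stmt-BirchSwinnertonDyer-21438 (parent Kμ⁺ `SignedMuVanishingAtTwoPlus` stmt-BirchSwinnertonDyer-20689, route ResidualThetaTransportAtTwo), stub S2

Cell `bsd-wall`, width seat `bsd-wall-rtt-p4-w2` g18 (`--supports`, closes nothing).  THEOREMS ONLY; BSD is not proved by this and
nothing arithmetic is asserted: module algebra.

`natCard_quotient_omega_eq_mul_pow` (`…GrowthLinear`) takes `T^{N₀}M ⊆ pM`; for a FINITE `M/pM` and `T ∈ Jac(R)` this is automatic (`T` acts nilpotently on a
finite module, `…TorsionExponent`).  Hence the cleanest module-level «`μ = 0` ⟹ linear growth»: over a commutative `R` with `p, T ∈ Jac(R)`, a Noetherian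
module `M` with `M/pM` finite has `#(M/ω_nM) = #(M/ω_{n₂}M)·c^{n−n₂}` for `n ≥ n₂`.  For `Λ = ℤ_p⟦T⟧ = IwasawaAlgebra p` the hypothesis is literally
`Finite (M ⧸ augIdealP p • ⊤)` — the tree's «`μ(M) = 0`» (`Literature…muInvariant_eq_zero_iff_holds` ⟺ f.g. over `ℤ_p`;
`moduleFinite_padicInt_of_finite_quotient_augIdealP`).  The card's `Λ' = 𝒪⟦T⟧`-module `Q'` is such a `Λ`-module by restriction of scalars.

* `T_pow_smul_top_le_of_finite_quotient` — `M/pM` finite, `T ∈ Jac(R)` ⟹ `span{T^{N₀}} • ⊤ ≤ span{p} • ⊤` for some `N₀`.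
* **`natCard_quotient_omega_eq_mul_pow_of_finite_quotient`**, **`padicValNat_natCard_quotient_omega_linear_of_finite_quotient`** — the cleanest forms.
* **`natCard_quotient_omega_eq_mul_pow_iwasawaAlgebra`** — `Λ = IwasawaAlgebra p`, hypothesis `Finite (M ⧸ augIdealP p • ⊤)`, `ω_n = (1+X)^{pⁿ} − 1`.

[folklore]
-/

set_option autoImplicit false
-- the Theorems namespace of this sub repeats the summit name by design (D-0017 nested layout)
set_option linter.dupNamespace false

open scoped Pointwise

namespace Summit.BirchSwinnertonDyer.BirchSwinnertonDyer.Theorems.SignedMuAtTwo.NonsquareDescent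

section FiniteQuotient

variable {R : Type*} [CommRing R] {M : Type*} [AddCommGroup M] [Module R M]

/-- `M/cM` finite and `T ∈ Jac(R)` ⟹ `T^{N₀} M ⊆ cM` for some `N₀` (`T` acts nilpotently on the finite module `M/cM`). [folklore] -/
theorem T_pow_smul_top_le_of_finite_quotient (c T : R) (hT : T ∈ (⊥ : Ideal R).jacobson)
    (hfin : Finite (M ⧸ Ideal.span {c} • (⊤ : Submodule R M))) :
    ∃ N₀ : ℕ, Ideal.span {T ^ N₀} • (⊤ : Submodule R M) ≤ Ideal.span {c} • ⊤ := by
  obtain ⟨N₀, hN₀⟩ := exists_pow_smul_eq_zero_of_mem_jacobson (B := M ⧸ Ideal.span {c} • (⊤ : Submodule R M)) hT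
  refine ⟨N₀, ?_⟩
  rw [Submodule.smul_le]
  intro r hr m _
  obtain ⟨a, rfl⟩ := Ideal.mem_span_singleton'.mp hr
  rw [mul_smul]
  refine Submodule.smul_mem _ a ?_
  have h0 := hN₀ (Submodule.Quotient.mk m)
  rw [← Submodule.Quotient.mk_smul, Submodule.Quotient.mk_eq_zero] at h0
  exact h0

/-- **`M/pM` finite ⟹ geometric growth of `#(M/ω_nM)` with constant ratio** (`p, T ∈ Jac(R)`, `M` Noetherian and finitely generated):
`∃ n₂ c, ∀ n ≥ n₂, #(M/ω_nM) = #(M/ω_{n₂}M)·c^{n−n₂}`, `ω_n = (1+T)^{pⁿ} − 1`. [folklore] -/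
theorem natCard_quotient_omega_eq_mul_pow_of_finite_quotient [Module.Finite R M] [IsNoetherian R M] (p : ℕ) (T : R)
    (hjac : Ideal.span {(p : R)} ≤ (⊥ : Ideal R).jacobson) (hT : T ∈ (⊥ : Ideal R).jacobson)
    (hfin : Finite (M ⧸ Ideal.span {(p : R)} • (⊤ : Submodule R M))) :
    ∃ (n₂ c : ℕ), ∀ n : ℕ, n₂ ≤ n →
      Nat.card (M ⧸ Ideal.span {(1 + T) ^ (p ^ n) - 1} • (⊤ : Submodule R M)) =
        Nat.card (M ⧸ Ideal.span {(1 + T) ^ (p ^ n₂) - 1} • (⊤ : Submodule R M)) * c ^ (n - n₂) := by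
  obtain ⟨N₀, hN₀⟩ := T_pow_smul_top_le_of_finite_quotient (p : R) T hT hfin
  obtain ⟨k, hk⟩ := exists_uniform_pow_torsion_of_isNoetherian (M := M) (p : R)
  exact natCard_quotient_omega_eq_mul_pow p T hjac N₀ hN₀ k hk

/-- The `p`-adic reading (`p` prime, all quotients finite): `ord_p #(M/ω_nM) = d·(n − n₂) + b` for `n ≥ n₂`. [folklore] -/
theorem padicValNat_natCard_quotient_omega_linear_of_finite_quotient [Module.Finite R M] [IsNoetherian R M] (p : ℕ) [Fact p.Prime] (T : R)
    (hjac : Ideal.span {(p : R)} ≤ (⊥ : Ideal R).jacobson) (hT : T ∈ (⊥ : Ideal R).jacobson)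
    (hfin : ∀ n : ℕ, Finite (M ⧸ Ideal.span {(1 + T) ^ (p ^ n) - 1} • (⊤ : Submodule R M)))
    (hfinp : Finite (M ⧸ Ideal.span {(p : R)} • (⊤ : Submodule R M))) :
    ∃ (n₂ d b : ℕ), ∀ n : ℕ, n₂ ≤ n →
      padicValNat p (Nat.card (M ⧸ Ideal.span {(1 + T) ^ (p ^ n) - 1} • (⊤ : Submodule R M))) = d * (n - n₂) + b := by
  obtain ⟨N₀, hN₀⟩ := T_pow_smul_top_le_of_finite_quotient (p : R) T hT hfinp
  obtain ⟨k, hk⟩ := exists_uniform_pow_torsion_of_isNoetherian (M := M) (p : R)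
  exact padicValNat_natCard_quotient_omega_linear p T hjac N₀ hN₀ k hk hfin

end FiniteQuotient

/-! ## The instance `Λ = ℤ_p⟦T⟧` (`IwasawaAlgebra p`) -/

section Iwasawa

open Literature.NumberTheory.EllipticCurves

variable (p : ℕ) [Fact p.Prime] {M : Type*} [AddCommGroup M] [Module (IwasawaAlgebra p) M]

/-- `X ∈ Jac(ℤ_p⟦X⟧)` and `(p) ⊆ Jac(ℤ_p⟦X⟧)` (local ring; `X`, `p` non-units). [folklore] -/
theorem X_mem_jacobson_and_span_p_le :
    (PowerSeries.X : IwasawaAlgebra p) ∈ (⊥ : Ideal (IwasawaAlgebra p)).jacobson ∧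
      Ideal.span {(p : IwasawaAlgebra p)} ≤ (⊥ : Ideal (IwasawaAlgebra p)).jacobson := by
  have hp : ¬ IsUnit (p : ℤ_[p]) := by
    rw [PadicInt.not_isUnit_iff, PadicInt.norm_lt_one_iff_dvd]
  refine ⟨?_, natCast_span_le_jacobson_bot_powerSeries p hp⟩
  have hX : ¬ IsUnit (PowerSeries.X : IwasawaAlgebra p) := by
    rw [PowerSeries.isUnit_iff_constantCoeff, PowerSeries.constantCoeff_X]
    exact not_isUnit_zero
  exact (Ideal.span_singleton_le_iff_mem _).mp (span_le_jacobson_bot_of_not_isUnit hX)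

/-- `augIdealP p = (p)` as the span of the natural-number cast. [folklore] -/
theorem augIdealP_eq_span_natCast : IwasawaAlgebra.augIdealP p = Ideal.span {(p : IwasawaAlgebra p)} := by
  rw [IwasawaAlgebra.augIdealP, ← map_natCast (PowerSeries.C (R := ℤ_[p])) p]

/-- **`Λ = ℤ_p⟦T⟧`: `M` finitely generated with `M/(p)M` finite (the tree's «`μ(M) = 0`» reading) ⟹ `#(M/ω_nM) = #(M/ω_{n₂}M)·c^{n−n₂}` for `n ≥ n₂`**,
`ω_n = (1+X)^{pⁿ} − 1`. [folklore] -/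
theorem natCard_quotient_omega_eq_mul_pow_iwasawaAlgebra [Module.Finite (IwasawaAlgebra p) M]
    (hfin : Finite (M ⧸ IwasawaAlgebra.augIdealP p • (⊤ : Submodule (IwasawaAlgebra p) M))) :
    ∃ (n₂ c : ℕ), ∀ n : ℕ, n₂ ≤ n →
      Nat.card (M ⧸ Ideal.span {((1 + PowerSeries.X : IwasawaAlgebra p)) ^ (p ^ n) - 1} • (⊤ : Submodule (IwasawaAlgebra p) M)) =
        Nat.card (M ⧸ Ideal.span {((1 + PowerSeries.X : IwasawaAlgebra p)) ^ (p ^ n₂) - 1} • (⊤ : Submodule (IwasawaAlgebra p) M)) *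
          c ^ (n - n₂) := by
  obtain ⟨hX, hp⟩ := X_mem_jacobson_and_span_p_le p
  rw [augIdealP_eq_span_natCast] at hfin
  exact natCard_quotient_omega_eq_mul_pow_of_finite_quotient p PowerSeries.X hp hX hfin

/-- The `p`-adic reading over `Λ = ℤ_p⟦T⟧`: with all `M/ω_nM` finite, `ord_p #(M/ω_nM) = d·(n − n₂) + b` for `n ≥ n₂`. [folklore] -/
theorem padicValNat_natCard_quotient_omega_linear_iwasawaAlgebra [Module.Finite (IwasawaAlgebra p) M]
    (hfinp : Finite (M ⧸ IwasawaAlgebra.augIdealP p • (⊤ : Submodule (IwasawaAlgebra p) M)))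
    (hfin : ∀ n : ℕ, Finite (M ⧸ Ideal.span {((1 + PowerSeries.X : IwasawaAlgebra p)) ^ (p ^ n) - 1} •
      (⊤ : Submodule (IwasawaAlgebra p) M))) :
    ∃ (n₂ d b : ℕ), ∀ n : ℕ, n₂ ≤ n →
      padicValNat p (Nat.card (M ⧸ Ideal.span {((1 + PowerSeries.X : IwasawaAlgebra p)) ^ (p ^ n) - 1} •
        (⊤ : Submodule (IwasawaAlgebra p) M))) = d * (n - n₂) + b := by
  obtain ⟨hX, hp⟩ := X_mem_jacobson_and_span_p_le p
  rw [augIdealP_eq_span_natCast] at hfinp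
  exact padicValNat_natCard_quotient_omega_linear_of_finite_quotient p PowerSeries.X hp hX hfin hfinp

end Iwasawa

end Summit.BirchSwinnertonDyer.BirchSwinnertonDyer.Theorems.SignedMuAtTwo.NonsquareDescent
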